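import Summits.BirchSwinnertonDyer.BirchSwinnertonDyer.Theses.KolyvaginRoadThree
import Summits.BirchSwinnertonDyer.Rank1Residual.X11b.RingClassFieldNoTorsion
import Summits.BirchSwinnertonDyer.Rank1Residual.X11b.Three.KolyvaginNonvanishing
import Mathlib.FieldTheory.Galois.Infinite
import HarnessLib

/-!
# Route `KolyvaginRoadThree`, crux `ZhangSharpFrameAtThree` (item stmt-BirchSwinnertonDyer-19153):
# McCallum's Cor. 4.5 BOTH WAYS for the tree's concrete Kolyvagin classes, and the crux read as a
# POINT-DIVISIBILITY statement (cell `bsd-stepL`, seat `bsd-stepL-zhang3-p1`; `--supports 19153`)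

THEOREMS ONLY (no definition, no named fact, no `sorry`); nothing about Kolyvagin's conjecture at
`p = 3` is asserted; nothing is booked.

The crux `Theses.KolyvaginRoadThree.ZhangSharpFrameAtThree` (= the hypothesis `hZ` of the landed
kernel `Koly.bsdp_three_onA1_of_kolyvaginFrames`, p410690) concludes, at every Manin-good conductor-1
frame `(Dt, β, ι)`, `∃ n d, KolSupp … n ∧ d.kolyvaginClass Nat.prime_three 1 ≠ 0` — a NON-ZERO
McCallum cocycle class `c₁(n) ∈ H¹(K, E[3])`.  Every supplier in sight (W. Zhang's induction re-run at
3, memo MEMO-v4 §§2–4; the BC5 rung `stub_rung_347253a1` = ONE derived-point certificate; the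
Jetchev–Lauter–Stein numerics) produces instead the POINT statement «`P(n) ∉ 3·E(K[n])`»
(`¬ Koly.PDiv d 3 1`).  The tree had only one direction of McCallum 1991, Cor. 4.5 between the two
currencies (`Koly.kolyvaginClass_eq_zero_of_pDiv`: `p^M ∣ P(n) ⇒ c_M(n) = 0`).  This file proves the
converse for the tree's CONCRETE data and packages the equivalence:

* `KolyCert.smul_toGeomPoints_of_forall_emb` — `Gal(K̄/K[n])` (the elements of `Γ_K` fixing
  `d.emb (K[n])` pointwise) fixes `E(K[n]) ⊆ E(K̄)` pointwise;
* `KolyCert.mem_pointsSubgroup_of_forall_smul_eq` — **Galois descent** `E(K̄)^{Gal(K̄/K[n])} = E(K[n])`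
  for the datum's embedding (Mathlib's infinite Galois correspondence
  `InfiniteGalois.fixedField_fixingSubgroup` at the intermediate field `d.emb (K[n])`);
* `KolyCert.kolyvaginClass_eq_zero_iff_pDiv` — **McCallum 1991, Cor. 4.5 / Gross 1991, Prop. 4.7 (1)**
  for `d : KolyvaginHeegnerData Dt β ι n` (`n ≠ 0`, `K` imaginary quadratic): on the admissible,
  invariant branch, `c_M(n) = 0 ↔ p^M ∣ P(n)` in `E(K[n])`;
* `KolyCert.kolyvaginClass_ne_zero_iff` — with NO standing hypothesis: `c_M(n) ≠ 0` iff
  (`E(K[n]) ⊆ E(K̄)` admissible for `p^M`) ∧ (`[P(n)]` is `Γ_K`-invariant mod `p^M`) ∧ `p^M ∤ P(n)`;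
* `KolyCert.kolyvaginClass_three_ne_zero_iff` — at `p = 3` under `Surj W 3` (admissibility SUPPLIED by
  `RingClassNoTorsion.isAdmissible_pointsSubgroup_three`, Gross Lemma 4.3): `c_M(n) ≠ 0` iff
  `[P(n)]` invariant mod `3^M` ∧ `3^M ∤ P(n)`;
* `KolyCert.zhangSharpFrameAtThree_iff_pointCertificates` — **the crux, verbatim, is equivalent to its
  point-divisibility form**: same binders, conclusion `∃ n d, KolSupp … n ∧ [P(n)] Γ_K-invariant mod 3 ∧
  P(n) ∉ 3·E(K[n])`.  This is the exact shape a derived-point certificate (BC5 rung, WANTED-K3) or a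
  formalised induction has to deliver; the invariance clause is McCallum's (4) / Gross's Prop. 3.6,
  supplied in the tree for Kolyvagin levels by `KolyvaginH44.kolyvaginPoint_mem_invPoints_of_dvd`
  (abstract Euler data) — it is NOT discharged here.

References (locators only): [cite: McCallumLMS1991, §4 (4)–(6), Cor. 4.5]
[cite: GrossLMS1991, §4 (4.1)–(4.4), Lemma 4.3, Prop. 4.7 (1)] [cite: SilvermanAEC2009, VIII.§1].
-/

noncomputable section

open scoped Classical

namespace Summit.BirchSwinnertonDyer.Rank1Residual.X11b.Three.KolyCert

open WeierstrassCurve Field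
open Literature.NumberTheory.EllipticCurves Literature.NumberTheory.EllipticCurves.ModularForms
open Literature.NumberTheory.EllipticCurves.KolyvaginCocycle
open Summit.BirchSwinnertonDyer.Rank1Residual.X11b.Three.Koly

-- `K : Type`: the tree's ring-class class field theory is universe `0`.
variable {K : Type} [Field K] [NumberField K] {N : ℕ} [NeZero N] {W : WeierstrassCurve ℚ}
  {Dt : ModularParametrizationData W N} {β : ℤ} {ι : K →+* ℂ} {n : ℕ}
  (d : KolyvaginHeegnerData Dt β ι n)

/-! ## §1 `Gal(K̄/K[n])` fixes `E(K[n]) ⊆ E(K̄)`; Galois descent to `K[n]` -/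

/-- An element of `Γ_K` fixing `d.emb (K[n]) ⊆ K̄` pointwise fixes every point of
`E(K[n]) ⊆ E(K̄)` (coordinates). Silverman *AEC* VIII.§1. [folklore] -/
theorem smul_toGeomPoints_of_forall_emb (g : absoluteGaloisGroup K)
    (hg : ∀ x : ringClassField K ι n,
      (show AlgebraicClosure K ≃ₐ[K] AlgebraicClosure K from g) (d.emb x) = d.emb x)
    (P : (W.baseChange (ringClassField K ι n)).toAffine.Point) :
    g • d.toGeomPoints P = d.toGeomPoints P := by
  rcases P with _ | ⟨x, y, hxy⟩
  · rfl
  · have hns1 : ((W.baseChange K).baseChange (AlgebraicClosure K)).toAffine.Nonsingular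
        (d.emb x) (d.emb y) :=
      (Affine.baseChange_nonsingular W d.emb.toRatAlgHom.injective x y).mpr hxy
    change Affine.Point.map (W' := W.baseChange K)
        ((show AlgebraicClosure K ≃ₐ[K] AlgebraicClosure K from g) :
          AlgebraicClosure K →ₐ[K] AlgebraicClosure K)
        (Affine.Point.some (d.emb x) (d.emb y) hns1) =
      Affine.Point.some (d.emb x) (d.emb y) hns1
    rw [Affine.Point.map_some]
    simp only [Affine.Point.some.injEq, AlgEquiv.coe_toAlgHom]
    exact ⟨hg x, hg y⟩

/-- **Galois descent `E(K̄)^{Gal(K̄/K[n])} = E(K[n])`** for the datum's embedding `d.emb : K[n] → K̄`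
(`n ≠ 0`, `K` imaginary quadratic, so that `K[n]/K` is a finite Galois extension and `d.emb (K[n])` an
intermediate field of `K̄/K`): a point of `E(K̄)` fixed by every `g ∈ Γ_K` that fixes `d.emb (K[n])`
pointwise lies in `d.pointsSubgroup = d.toGeomPoints (E(K[n]))` — its coordinates lie in the fixed field of
the fixing subgroup of `d.emb (K[n])`, which is `d.emb (K[n])` by the infinite Galois correspondence
(Mathlib `InfiniteGalois.fixedField_fixingSubgroup`; `K̄/K` is Galois since `K` is perfect). This is the
hypothesis `hAN` of the tree's `kolyvaginClass_eq_zero_iff` for the printed `A = E(K_n)`,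
`N = Gal(K̄/K_n)`. Silverman *AEC* VIII.§1; Gross 1991, proof of Prop. 4.7 (1). [folklore] -/
theorem mem_pointsSubgroup_of_forall_smul_eq (v : geomPoints (W.baseChange K))
    (hv : ∀ g : absoluteGaloisGroup K,
      (∀ x : ringClassField K ι n,
        (show AlgebraicClosure K ≃ₐ[K] AlgebraicClosure K from g) (d.emb x) = d.emb x) →
      g • v = v) :
    v ∈ d.pointsSubgroup := by
  letI : Algebra (ringClassField K ι n) (AlgebraicClosure K) := d.emb.toAlgebra
  haveI : IsScalarTower K (ringClassField K ι n) (AlgebraicClosure K) :=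
    IsScalarTower.of_algebraMap_eq fun k ↦ (d.emb_apply k).symm
  haveI : IsGalois K (AlgebraicClosure K) := {}
  -- the intermediate field `L = d.emb (K[n])` of `K̄/K`
  set L : IntermediateField K (AlgebraicClosure K) :=
    (IsScalarTower.toAlgHom K (ringClassField K ι n) (AlgebraicClosure K)).fieldRange with hL
  have hmemL : ∀ z : AlgebraicClosure K, z ∈ L ↔ ∃ x : ringClassField K ι n, d.emb x = z := by
    intro z
    rw [hL, AlgHom.mem_fieldRange]
    rfl
  -- the elements of `L.fixingSubgroup` are exactly the `g` fixing `d.emb (K[n])` pointwise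
  have hfixing : ∀ g : AlgebraicClosure K ≃ₐ[K] AlgebraicClosure K, g ∈ L.fixingSubgroup →
      ∀ x : ringClassField K ι n, g (d.emb x) = d.emb x := by
    intro g hg x
    rw [IntermediateField.mem_fixingSubgroup_iff] at hg
    exact hg _ ((hmemL _).mpr ⟨x, rfl⟩)
  -- coordinates of a fixed element lie in the fixed field of `L.fixingSubgroup`, i.e. in `L`
  have hcoord : ∀ z : AlgebraicClosure K,
      (∀ g : AlgebraicClosure K ≃ₐ[K] AlgebraicClosure K, g ∈ L.fixingSubgroup → g z = z) →
      ∃ x : ringClassField K ι n, d.emb x = z := by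
    intro z hz
    rw [← hmemL, ← InfiniteGalois.fixedField_fixingSubgroup L, IntermediateField.mem_fixedField_iff]
    exact fun g hg ↦ hz g hg
  rcases v with _ | ⟨vx, vy, hv0⟩
  · exact d.pointsSubgroup.zero_mem
  · have hxy : ∀ g : AlgebraicClosure K ≃ₐ[K] AlgebraicClosure K, g ∈ L.fixingSubgroup →
        g vx = vx ∧ g vy = vy := by
      intro g hg
      have h := hv g (hfixing g hg)
      change Affine.Point.map (W' := W.baseChange K) (g : AlgebraicClosure K →ₐ[K] AlgebraicClosure K)
          (Affine.Point.some vx vy hv0) = Affine.Point.some vx vy hv0 at h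
      rw [Affine.Point.map_some] at h
      simpa only [Affine.Point.some.injEq, AlgEquiv.coe_toAlgHom] using h
    obtain ⟨x, hx⟩ := hcoord vx fun g hg ↦ (hxy g hg).1
    obtain ⟨y, hy⟩ := hcoord vy fun g hg ↦ (hxy g hg).2
    subst hx hy
    have hxy0 : (W.baseChange (ringClassField K ι n)).toAffine.Nonsingular x y :=
      (Affine.baseChange_nonsingular W d.emb.toRatAlgHom.injective x y).mp hv0
    refine ⟨Affine.Point.some x y hxy0, ?_⟩
    change Affine.Point.map (W' := W) d.emb.toRatAlgHom (Affine.Point.some x y hxy0) = _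
    rw [Affine.Point.map_some]
    rfl

/-! ## §2 McCallum 1991, Cor. 4.5, both directions, for concrete data -/

/-- **McCallum 1991, Cor. 4.5 / Gross 1991, Prop. 4.7 (1) for the tree's concrete Kolyvagin classes**:
for a Kolyvagin–Heegner datum `d` of conductor `n ≠ 0` over an imaginary quadratic `K`, on the standing
inputs of the cocycle — `E(K[n]) ⊆ E(K̄)` admissible for `p^M` (`hA`, Gross Lemma 4.3) and `[P(n)]`
`Γ_K`-invariant mod `p^M` (`hP`, McCallum (4) / Gross Prop. 3.6) — the class `c_M(n) = d.kolyvaginClass hp M`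
VANISHES iff `p^M ∣ P(n)` in `E(K[n])` (`Koly.PDiv d p M`): *"`c_M(n) = 0` if and only if
`P_n ∈ p^M E(K_n)`"*. The tree's abstract `kolyvaginClass_eq_zero_iff` at `N = Gal(K̄/K[n])`
(`smul_toGeomPoints_of_forall_emb`, `mem_pointsSubgroup_of_forall_smul_eq`), read back in `E(K[n])` along
the injective `d.toGeomPoints`. [cite: McCallumLMS1991, Cor. 4.5] [cite: GrossLMS1991, Prop. 4.7 (1)] -/
theorem kolyvaginClass_eq_zero_iff_pDiv {p : ℕ} (hp : p.Prime) (M : ℕ)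
    (hA : IsAdmissible (absoluteGaloisGroup K) d.pointsSubgroup ((p ^ M : ℕ) : ℤ))
    (hP : d.toGeomPoints d.derivedPoint ∈
      invPoints (absoluteGaloisGroup K) d.pointsSubgroup ((p ^ M : ℕ) : ℤ)) :
    d.kolyvaginClass hp M = 0 ↔ PDiv d p M := by
  rw [d.kolyvaginClass_of_admissible hp M hA hP,
    kolyvaginClass_eq_zero_iff hA hP
      (N := {g : absoluteGaloisGroup K | ∀ x : ringClassField K ι n,
        (show AlgebraicClosure K ≃ₐ[K] AlgebraicClosure K from g) (d.emb x) = d.emb x})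
      (fun g hg ↦ smul_toGeomPoints_of_forall_emb d g hg _)
      (fun v hv ↦ mem_pointsSubgroup_of_forall_smul_eq d v fun g hg ↦ hv g hg)]
  constructor
  · rintro ⟨_, ⟨Q, rfl⟩, hQ⟩
    refine ⟨Q, Affine.Point.map_injective (W' := W) d.emb.toRatAlgHom ?_⟩
    change d.toGeomPoints (((p ^ M : ℕ) : ℤ) • Q) = d.toGeomPoints d.derivedPoint
    rw [map_zsmul]
    exact hQ
  · rintro ⟨Q, hQ⟩
    exact ⟨d.toGeomPoints Q, ⟨Q, rfl⟩, by rw [← map_zsmul, hQ]⟩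

/-- **`c_M(n) ≠ 0` characterised with NO standing hypothesis** (`n ≠ 0`, `K` imaginary quadratic):
`d.kolyvaginClass hp M ≠ 0` iff `E(K[n]) ⊆ E(K̄)` is admissible for `p^M`, `[P(n)]` is `Γ_K`-invariant mod
`p^M`, AND `p^M ∤ P(n)` in `E(K[n])`. (`⇒`: a non-zero class is never the junk value —
`KolyvaginHeegnerData.kolyvaginClass_ne_zero` — and is a certificate, `Koly.not_pDiv_of_kolyvaginClass_ne_zero`;
`⇐`: `kolyvaginClass_eq_zero_iff_pDiv`.) [cite: McCallumLMS1991, §4 (4)–(6) and Cor. 4.5] -/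
theorem kolyvaginClass_ne_zero_iff {p : ℕ} (hp : p.Prime) (M : ℕ) :
    d.kolyvaginClass hp M ≠ 0 ↔
      IsAdmissible (absoluteGaloisGroup K) d.pointsSubgroup ((p ^ M : ℕ) : ℤ) ∧
        d.toGeomPoints d.derivedPoint ∈
          invPoints (absoluteGaloisGroup K) d.pointsSubgroup ((p ^ M : ℕ) : ℤ) ∧
        ¬ PDiv d p M := by
  refine ⟨fun h ↦ ⟨(d.kolyvaginClass_ne_zero h).1, (d.kolyvaginClass_ne_zero h).2,
    not_pDiv_of_kolyvaginClass_ne_zero d h⟩, ?_⟩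
  rintro ⟨hA, hP, hdiv⟩ h0
  exact hdiv ((kolyvaginClass_eq_zero_iff_pDiv d hp M hA hP).mp h0)

/-- **At `p = 3` under `Surj W 3`** (`ρ̄_{E,3}` onto; `W` elliptic, `K` imaginary quadratic, `n ≠ 0`):
admissibility of `E(K[n]) ⊆ E(K̄)` for `3^M` is the tree theorem
`RingClassNoTorsion.isAdmissible_pointsSubgroup_three` (Gross 1991, Lemma 4.3 at the ring class field), so
`c_M(n) ≠ 0` iff `[P(n)]` is `Γ_K`-invariant mod `3^M` and `3^M ∤ P(n)` in `E(K[n])`.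
[cite: McCallumLMS1991, Cor. 4.5] [cite: GrossLMS1991, Lemma 4.3 and Prop. 4.7 (1)] -/
theorem kolyvaginClass_three_ne_zero_iff [W.IsElliptic] (hK : IsImaginaryQuadratic K) (hn : n ≠ 0)
    (hsurj : Rank1Residual.Surj W 3) (M : ℕ) :
    d.kolyvaginClass Nat.prime_three M ≠ 0 ↔
      d.toGeomPoints d.derivedPoint ∈
          invPoints (absoluteGaloisGroup K) d.pointsSubgroup ((3 ^ M : ℕ) : ℤ) ∧
        ¬ PDiv d 3 M := by
  rw [kolyvaginClass_ne_zero_iff]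
  exact ⟨fun h ↦ h.2, fun h ↦
    ⟨RingClassNoTorsion.isAdmissible_pointsSubgroup_three d hK hn hsurj M, h⟩⟩

/-! ## §3 The crux `ZhangSharpFrameAtThree` as a point-divisibility statement -/

/-- **The crux of route `KolyvaginRoadThree`, verbatim, is EQUIVALENT to its point-divisibility form.**
`Theses.KolyvaginRoadThree.ZhangSharpFrameAtThree` (Kolyvagin's conjecture mod 3 at `3 ∥ N` on atom A1,
at every Manin-good conductor-1 frame: `∃ n d, KolSupp … n ∧ c₁(n) ≠ 0`) holds iff, under the SAME
binders, there are a square-free product `n` of Kolyvagin primes for `p = 3` and a Kolyvagin–Heegner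
datum `d` of conductor `n` on the frame whose derived point `P(n) ∈ E(K[n])` has `Γ_K`-INVARIANT class
mod 3 (McCallum's (4); `invPoints`) and is NOT divisible by 3 in `E(K[n])` (`¬ Koly.PDiv d 3 1`).
Pointwise `kolyvaginClass_three_ne_zero_iff` (`n ≠ 0` since `n` is square-free; `Surj W 3` and
`IsImaginaryQuadratic K` are binders of the crux). A REFORMULATION: nothing is asserted about either
side. [cite: McCallumLMS1991, Cor. 4.5] [cite: GrossLMS1991, Prop. 4.7 (1)] -/
theorem zhangSharpFrameAtThree_iff_pointCertificates :
    Summit.BirchSwinnertonDyer.BirchSwinnertonDyer.Theses.KolyvaginRoadThree.ZhangSharpFrameAtThree ↔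
      ∀ (W : WeierstrassCurve ℚ) [W.IsElliptic] [W.IsGloballyMinimal] [NeZero (W.conductorNorm ℤ)]
        (K : Type) [Field K] [NumberField K]
        (Dt : ModularParametrizationData W (W.conductorNorm ℤ)) (β : ℤ) (ι : K →+* ℂ),
        W.HasMultiplicativeReductionAtPrime 3 → Rank1Residual.Surj W 3 → Rank1Residual.Ram W 3 →
        ¬ 3 ∣ W.tamagawaProduct → IsImaginaryQuadratic K →
        SatisfiesHeegnerHypothesis (W.conductorNorm ℤ) K → NumberField.discr K ≠ -3 →
        (4 * (W.conductorNorm ℤ : ℤ)) ∣ β ^ 2 - NumberField.discr K → ¬ (3 : ℤ) ∣ Dt.c →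
        ∃ (n : ℕ) (d : KolyvaginHeegnerData Dt β ι n),
          KolyvaginDescent.KolSupp (Zhang2014.IsKolyvaginPrime (W.conductorNorm ℤ) W K 3) n ∧
            d.toGeomPoints d.derivedPoint ∈
              invPoints (absoluteGaloisGroup K) d.pointsSubgroup ((3 ^ 1 : ℕ) : ℤ) ∧
            ¬ PDiv d 3 1 := by
  constructor
  · intro hZ W _ _ _ K _ _ Dt β ι hmult hsurj hram htam hK hH h3 hβ hc
    obtain ⟨n, d, hn, hne⟩ := hZ W K Dt β ι hmult hsurj hram htam hK hH h3 hβ hc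
    exact ⟨n, d, hn, (kolyvaginClass_three_ne_zero_iff d hK hn.1.ne_zero hsurj 1).mp hne⟩
  · intro hC W _ _ _ K _ _ Dt β ι hmult hsurj hram htam hK hH h3 hβ hc
    obtain ⟨n, d, hn, hP, hdiv⟩ := hC W K Dt β ι hmult hsurj hram htam hK hH h3 hβ hc
    exact ⟨n, d, hn, (kolyvaginClass_three_ne_zero_iff d hK hn.1.ne_zero hsurj 1).mpr ⟨hP, hdiv⟩⟩

end Summit.BirchSwinnertonDyer.Rank1Residual.X11b.Three.KolyCert

end
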